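import Summits.QuantumFields.YangMills.Theorems.BalabanLadderUVSeamRecTorusCeiling
import Summits.QuantumFields.YangMills.Theorems.BalabanLadderUVSeamRecResponseMomentsPinning
import Summits.QuantumFields.YangMills.Theorems.BalabanLadderUVSeamRecClassicalResponseSemiclassical
import Summits.QuantumFields.YangMills.Theorems.BalabanLadderNTReferenceTransfer
import HarnessLib

/-!
# Crux `UVSeamRec` (stmt-QuantumFields-20043): COLD-WALL EXTREMALITY BUYS THE R-UNIFORM CENTRE CEILING —
# line «extremal_coldwall»'s (CWX) at one point ⇒ `kerE^{𝟙}_{β,R}(2 − plane q x) ≤ ⟨2 − plane q x⟩_{2L+1,β} ≤ 29/β`, every `R`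

Helper file (`--supports stmt-QuantumFields-20043`) of the LEAD seat `ym-spine-20043-p1` (gen 12).  The LEAD lineage and tempered-d1 sized the POINTWISE cold-wall
centre ceiling uniform in the radius (Tier 3, the «second lemma» of line «coldwall_pure»'s hardest stub) as out of reach of elementary means (no translation
invariance in the cube, no Griffiths/FKG for `SU(2)`).  Line «extremal_coldwall» (ideator ym-idea-10 g2; idea-crit-9 VERDICT #14 PASS-WITH-PRICE) posits the SIGN
(CWX): among all exteriors `η` of the Dirichlet cube `(x − R − 1, 2R+3)` the cold wall maximises the expected centre plaquette.  This file records the located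
implication, kernel-checked: (CWX) AT ONE POINT `(β, R, q, x)` is exactly the missing lever for Tier 3 there —
* **`kerE_one_deficit_le_torusE_of_extremal`** — for every compact `G`, lattice representation `r`, `β`, `R + 2 ≤ L`, `q`, `x`: if
  `kerE^η(plane q x) ≤ kerE^{𝟙}(plane q x)` for every exterior `η`, then `kerE^{𝟙}(N − plane q x) ≤ ⟨N − plane q x⟩_{2L+1,β}` (torus DLR
  `ResponsePinning.torusE_plane_eq_torusE_kerE` + monotonicity of the torus state + the Feller property `NT.Reference.continuous_kerE`);
* **`kerE_one_deficit_le_of_extremal`** — `SU(2)`, `β ≥ 2`, every `R`, `q.1 < q.2`, `x`: (CWX) at `(β, R, q, x)` ⇒ `kerE^{𝟙}_{β,R}(2 − plane q x) ≤ 29/β`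
  (gen 11's torus ceiling `ThermalFloor.torusE_two_sub_plane_le_of_log_le` on the odd torus of half-side `L = R + 2 + ⌈β⌉₊ ≥ log β`), UNIFORMLY IN `R` — versus the
  hypothesis-free fixed-radius bounds `120(2R+3)⁴(34 + 6 log β)/β` (gen 11) / `120(2R+3)⁴·92/β` (gen 12).
So on the (RM)-currency family of lines the two open levers «pointwise cold-wall ceiling uniform in R» (coldwall_pure) and «cold-wall extremality» (extremal_coldwall)
are ordered: CWX ⇒ Tier 3 pointwise.  HONEST FRAMING: a CONDITIONAL bookkeeping lemma (hypothesis = an OPEN stub of a candidate line); nothing of E0′, NT or the gap;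
not Clay.
-/

open MeasureTheory
open Literature.MathematicalPhysics.QuantumFieldTheory (LatticeRep isProbabilityMeasure_wilsonMeasure)
open Literature.MathematicalPhysics.QuantumLattice (fundamentalLatticeRep LGConfig)
open Summit.QuantumFields.YangMills.Cruxes.OSLegsFromFemtoAndGap.DlrCollarTransfer

noncomputable section

namespace Summit.QuantumFields.YangMills.Cruxes.UVSeamRec.ClassicalResponse.ColdWall

section General

variable (G : Type) [Group G] [TopologicalSpace G] [IsTopologicalGroup G] [CompactSpace G] [MeasurableSpace G] [BorelSpace G]
  (r : LatticeRep G)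

/-- The torus expectation of `p − F` for a continuous observable `F`. [folklore] -/
theorem torusE_const_sub (β : ℝ) (L : ℕ) {F : LGConfig 4 G → ℝ} (hF : Continuous F) (p : ℝ) :
    torusE G r β L (fun U => p - F U) = p - torusE G r β L F := by
  haveI := r.secondCountableTopology
  haveI := isProbabilityMeasure_wilsonMeasure (d := 4) (L := 2 * L + 1) r.ρ r.continuous β
  unfold torusE
  rw [integral_sub (integrable_const p) (ResponsePinning.integrable_comp_lift r β L hF), integral_const, smul_eq_mul,
    probReal_univ, one_mul]

/-- **Cold-wall extremality at a point puts the cold-wall centre deficit below the torus mean.**  For every compact `G`, lattice representation `r`, `β`,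
radius `R`, odd torus of half-side `L ≥ R + 2`, orientation `q` and site `x`: if the cold wall maximises the kernel mean of `plane q x` among all exteriors of the
cube `(x − R − 1, 2R+3)` (line «extremal_coldwall»'s (CWX) at this point), then `kerE^{𝟙}(N − plane q x) ≤ ⟨N − plane q x⟩_{2L+1,β}` — torus DLR through the cube,
monotonicity of the torus state, continuity of the kernel mean in the exterior. [folklore: Georgii (2011) Thm. 4.17] -/
theorem kerE_one_deficit_le_torusE_of_extremal (β : ℝ) (R L : ℕ) (hRL : R + 2 ≤ L) (q : Fin 4 × Fin 4) (x : Fin 4 → ℤ)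
    (hCWX : ∀ η : LGConfig 4 G, kerE G r β (fun k => x k - (R + 1)) (2 * R + 3) η (plane G r q x) ≤
      kerE G r β (fun k => x k - (R + 1)) (2 * R + 3) (fun _ => 1) (plane G r q x)) :
    kerE G r β (fun k => x k - (R + 1)) (2 * R + 3) (fun _ => 1) (fun U => (r.N : ℝ) - plane G r q x U) ≤
      torusE G r β L (fun U => (r.N : ℝ) - plane G r q x U) := by
  obtain ⟨C, hC⟩ := exists_abs_plane_le (G := G) r
  -- the kernel mean of `plane` is continuous in the exterior and dominated by the cold wall
  have hcont : Continuous fun η : LGConfig 4 G => kerE G r β (fun k => x k - (R + 1)) (2 * R + 3) η (plane G r q x) :=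
    NT.Reference.continuous_kerE G r β _ _ (continuous_plane r q x) (hC q x)
  have hDLR := ResponsePinning.torusE_plane_eq_torusE_kerE (G := G) r β q x R L hRL
  have hmono : torusE G r β L (fun η => kerE G r β (fun k => x k - (R + 1)) (2 * R + 3) η (plane G r q x)) ≤
      torusE G r β L (fun _ => kerE G r β (fun k => x k - (R + 1)) (2 * R + 3) (fun _ => 1) (plane G r q x)) :=
    ResponsePinning.torusE_mono r β L hcont continuous_const hCWX
  rw [ResponsePinning.torusE_const, ← hDLR] at hmono
  -- pass to the deficits
  rw [kerE_const_sub r β _ _ _ (continuous_plane r q x), torusE_const_sub G r β L (continuous_plane r q x)]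
  linarith

end General

/-- **(CWX) ⇒ THE R-UNIFORM COLD-WALL CENTRE CEILING (`SU(2)`).**  For `β ≥ 2`, every radius `R`, orientation `q.1 < q.2` and site `x`: if the cold wall maximises
the kernel mean of `plane q x` among all exteriors of the cube `(x − R − 1, 2R+3)` at inverse coupling `β` (line «extremal_coldwall»'s `stub_coldWallExtremal` at this
point), then `kerE^{𝟙}_{β,R}(2 − plane q x) ≤ 29/β` — Tier 3 of tempered-d1's memo (the «second lemma» of line «coldwall_pure»), with a constant INDEPENDENT OF `R`
(gen 11's torus ceiling on the odd torus of half-side `R + 2 + ⌈β⌉₊`, whose side exceeds `log β`). [folklore] -/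
theorem kerE_one_deficit_le_of_extremal {β : ℝ} (hβ : 2 ≤ β) (R : ℕ) (q : Fin 4 × Fin 4) (hq : q.1 < q.2) (x : Fin 4 → ℤ)
    (hCWX : ∀ η : LGConfig 4 (Matrix.specialUnitaryGroup (Fin 2) ℂ),
      kerE (Matrix.specialUnitaryGroup (Fin 2) ℂ) (fundamentalLatticeRep 2) β (fun k => x k - (R + 1)) (2 * R + 3) η
          (plane (Matrix.specialUnitaryGroup (Fin 2) ℂ) (fundamentalLatticeRep 2) q x) ≤
        kerE (Matrix.specialUnitaryGroup (Fin 2) ℂ) (fundamentalLatticeRep 2) β (fun k => x k - (R + 1)) (2 * R + 3) (fun _ => 1)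
          (plane (Matrix.specialUnitaryGroup (Fin 2) ℂ) (fundamentalLatticeRep 2) q x)) :
    kerE (Matrix.specialUnitaryGroup (Fin 2) ℂ) (fundamentalLatticeRep 2) β (fun k => x k - (R + 1)) (2 * R + 3) (fun _ => 1)
        (fun U => 2 - plane (Matrix.specialUnitaryGroup (Fin 2) ℂ) (fundamentalLatticeRep 2) q x U) ≤ 29 / β := by
  set L : ℕ := R + 2 + ⌈β⌉₊ with hL
  have hRL : R + 2 ≤ L := by omega
  have hL1 : 1 ≤ L := by omega
  have hlog : Real.log β ≤ (2 * L + 1 : ℕ) := by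
    have h1 : Real.log β ≤ β := (Real.log_le_sub_one_of_pos (by linarith)).trans (by linarith)
    have h2 : β ≤ ⌈β⌉₊ := Nat.le_ceil β
    have h3 : ((⌈β⌉₊ : ℕ) : ℝ) ≤ (2 * L + 1 : ℕ) := by
      have : ⌈β⌉₊ ≤ 2 * L + 1 := by omega
      exact_mod_cast this
    linarith
  have h := kerE_one_deficit_le_torusE_of_extremal (Matrix.specialUnitaryGroup (Fin 2) ℂ) (fundamentalLatticeRep 2) β R L hRL q x hCWX
  have hN : ((fundamentalLatticeRep 2).N : ℝ) = 2 := by simp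
  simp only [hN] at h
  have htorus := ThermalFloor.torusE_two_sub_plane_le_of_log_le hβ hL1 hlog q hq x
  rw [torusE_const_sub _ (fundamentalLatticeRep 2) β L (continuous_plane (fundamentalLatticeRep 2) q x)] at h
  linarith

end Summit.QuantumFields.YangMills.Cruxes.UVSeamRec.ClassicalResponse.ColdWall

end
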